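import Literature.AnabelianGeometry.EtaleTheta.Discharge.Sec5Thm510iiiDegenerateCriterion
import Literature.AnabelianGeometry.EtaleTheta.Discharge.Sec5DegenerateDatumEnv
import Literature.AnabelianGeometry.EtaleTheta.Discharge.Sec5BiThetaIso
import Literature.AnabelianGeometry.EtaleTheta.Discharge.Sec5Lem59vUniversalClosureRefuted

/-!
# [EtTh] §5, Lemma 5.9 (iv)/(v): the schemata `EnvIsoBiTheta`, `FrdIsMonoThetaEnv` DECIDED at the degenerate §5 datum — criterion and positive instances (p. 332 / PDF p. 106)

Mochizuki, *The étale theta function and its Frobenioid-theoretic manifestations*, Publ. RIMS **45**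
(2009) [cite: MochizukiEtTh2009, Lem 5.9 (iv) p.332 (PDF p.106)].  abc-iut cell, block F (fact-proving wave), seat
abc-iut-f-123 (owner of tranche 123 = FACT-LIST rows F-0544 `CycRigidityCoincide`, **F-0545 `EnvIsoBiTheta`**,
**F-0546 `FrdIsMonoThetaEnv`**, F-0547 `MonoThetaEnvCompat` of abc-iut-L2-t4's `FrobenioidMonoThetaEnv.lean`).
PROOF-ONLY companion (theorems only, nothing landed is edited or restated) of
* abc-iut-f-115's `Discharge/Sec5DegenerateDatum{,Kummer,Env}.lean` — the degenerate §5 datum `Sec5Toy.datum` over the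
  one-object base (`Aut_C(B_N) = 1`, `N = 1`, `Π^tp_X̲ = ℤ × ℤ × ℤ` discrete and abelian, `D_Y = 1`) and the NEGATIVE
  instances `not_envIsoBiTheta_datum_univ/_swap`, `not_frdIsMonoThetaEnv_datum` (universal closures of F-0545/F-0546
  refuted);
* this seat's `Discharge/Sec5Thm510iiiDegenerateCriterion.lean` (gen 0: `conjOut_eq_one`, `frdD_eq_closure` — `D = ⟨DK⟩`
  at the datum — and the F-0547 criterion);
* abc-iut-L2-t11's `Discharge/Sec5BiThetaIso.lean` — the INSTANCE FORM OF RECORD `ThetaFrobenioid.envIsoBiTheta_of`: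
  Lemma 5.9 (iv) "the natural inclusions `μ_N(B_N) ↪ E_N`, `Im(Π^tp_Y) ⊆ E_N` determine an isomorphism of topological
  groups `E^Π_N ⥲ Π^tp_Y[μ_N]` which is an isomorphism of mod `N` bi-theta environments" (p.332 (PDF p.106)) MODULO the
  seven §5 ↔ §2 dictionary hypotheses `Facts`, `IdentifiesPiY`, `IdentifiesPiYdd`, `CyclotomicCharacterCompatX`,
  `ThetaSectionCompat`, `ConstOutTransported`, `KummerOutReached`;
* abc-iut-w5-d026's `Discharge/Sec5Lem59vUniversalClosureRefuted.lean` (`cycRigidityCoincide_of_N_eq_one`, F-0544).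

STATE OF THE TREE BEFORE THIS FILE (tranche 123, rows F-0545/F-0546): every POSITIVE form is conditional
(`envIsoBiTheta_of/_birat/_canonical/_of_geometric/_of_galoisDictionary`, `frdIsMonoThetaEnv_of'/…`) and every
unconditional form is NEGATIVE — neither typed predicate had a kernel inhabitant, and the hypothesis bundle of the
instance form of record had no joint-satisfiability witness.  PROVED here (FACT-LIST R5: named instances):
* the dictionary of `envIsoBiTheta_of` DISCHARGED at the datum — `identifiesPiY_of_map_eq`, `identifiesPiYdd_of_map_eq`
  (for every `ι` carrying `Π^tp_Y̲, Π^tp_Ÿ̲` onto `Π^tp_Y, Π^tp_Ÿ`), `cyclotomicCharacterCompatX_datum`,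
  `thetaSectionCompat_datum` (for every `ι`, `m`, `η`: `μ_1 = 1`), `constOutTransported_datum_of_subset_one` (for every
  `DK ⊆ {1}`: `constOut = {1}` by `conjOut_eq_one`, `D_Y = 1`), `kummerOutReached_datum` (every Kummer shift is `1`) —
  in particular the seven hypotheses are JOINTLY SATISFIABLE (each holds for all choices of the earlier data);
* **`envIsoBiTheta_datum_of_subset_one`** — F-0545 HOLDS at the datum, THROUGH `envIsoBiTheta_of`, for every `DK ⊆ {1}`
  and every continuous `ι` carrying `Π^tp_Y̲, Π^tp_Ÿ̲` onto `Π^tp_Y, Π^tp_Ÿ`; named instances `envIsoBiTheta_datum_empty`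
  (`DK = ∅`, `ι = id`: print's `D = ⟨l·ℤ, K^×⟩` has no free part) and `frdIsMonoThetaEnv_datum_empty` (F-0546);
* **`eq_one_of_frdIsMonoThetaEnv`** — conversely, for ANY §2 datum with `D_Y = 1`, `FrdIsMonoThetaEnv … DK T` forces
  `DK ⊆ {1}` (an isomorphism of mono-theta environments transports `D = ⟨DK⟩` injectively onto `D_Y`);
* **CRITERIA** `frdIsMonoThetaEnv_datum_iff : FrdIsMonoThetaEnv … DK thetaEnvData ↔ DK ⊆ {1}` and
  `envIsoBiTheta_datum_iff : EnvIsoBiTheta … DK thetaEnvData ι ↔ (ι(Π^tp_Y̲) = Π^tp_Y ∧ ι(Π^tp_Ÿ̲) = Π^tp_Ÿ) ∧ DK ⊆ {1}`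
  for EVERY `DK` and EVERY continuous `ι` — the typed Lemma 5.9 (iv) predicates are LOCATED exactly: they fail only
  through the free Kummer part `DK` (abc-iut-L2-t4's `TODO-merge` placeholder for the `K^×`-part of `D`; RQ7 finding F1
  of abc-iut-L6-t23) or a mis-identification `ι`; f-115's three negatives are re-derived from the criteria
  (`not_univ_subset_one`, `map_PiY_swapTop_ne`);
* `cycRigidityCoincide_datum` — F-0544 holds at the datum for all parameters (`N = 1`, w5-d026's boundary theorem), so
  with this seat's F-0547 criterion the truth table of tranche 123 at the degenerate datum is complete.
HONEST FRAMING: instances and criteria for typed PREDICATES with free parameters at a degenerate datum that is NOT the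
tempered Frobenioid of a curve; nothing of [EtTh] is asserted or refuted; an instance at the datum does not prove the
FACT-LIST row for the genuine data; typed ≠ proved; nothing here bears on [IUTchIII] Cor. 3.12 and no side is taken.
-/

namespace Literature.AnabelianGeometry.EtaleTheta

open CategoryTheory Literature.AlgebraicGeometry.Frobenioids

namespace Sec5Toy

/-! ### The §5 ↔ §2 dictionary of `envIsoBiTheta_of`, discharged at the degenerate datum -/

section Dictionary

variable (ι : datum.PiX ≃ₜ* thetaEnvData.PiX)

/-- `μ_1(B_N) ≃ μ_1`: both cyclotomes of the degenerate datum are trivial groups, so an identification `m` exists.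
[cite: MochizukiEtTh2009, Lem 5.9 (iv) p.332 (PDF p.106)] -/
theorem nonempty_muEquiv : Nonempty (datum.muTorsion datum.BN datum.N ≃* thetaEnvData.mu) := by
  haveI := subsingleton_aut_BN
  refine ⟨?_⟩
  exact
    { toFun := fun _ => PUnit.unit
      invFun := fun _ => 1
      left_inv := fun _ => Subsingleton.elim _ _
      right_inv := fun _ => rfl
      map_mul' := fun _ _ => rfl }

/-- An identification `ι` with `ι(Π^tp_Y̲) = Π^tp_Y` "carries `Π^tp_Y̲` onto `Π^tp_Y`" elementwise (abc-iut-L2-t4's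
`IdentifiesPiY`).  [cite: MochizukiEtTh2009, Lem 5.9 (iv) p.332 (PDF p.106)] -/
theorem identifiesPiY_of_map_eq (hY : datum.PiY.map ι.toMulEquiv.toMonoidHom = thetaEnvData.PiY) :
    datum.IdentifiesPiY thetaEnvData ι.toMulEquiv := by
  intro y
  constructor
  · intro hy
    exact hY.le ⟨y, hy, rfl⟩
  · intro hy
    obtain ⟨z, hz, hzy⟩ := hY.ge hy
    have hz' : z = y := ι.injective hzy
    rw [← hz']
    exact hz

/-- An identification `ι` with `ι(Π^tp_Ÿ̲) = Π^tp_Ÿ` "carries `Π^tp_Ÿ̲` onto `Π^tp_Ÿ`" elementwise (abc-iut-L2-t11's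
`IdentifiesPiYdd`).  [cite: MochizukiEtTh2009, Lem 5.9 (iv) p.332 (PDF p.106)] -/
theorem identifiesPiYdd_of_map_eq (hYdd : datum.PiYdd.map ι.toMulEquiv.toMonoidHom = thetaEnvData.PiYdd) :
    datum.IdentifiesPiYdd thetaEnvData ι.toMulEquiv := by
  intro y
  constructor
  · intro hy
    exact hYdd.le ⟨y, hy, rfl⟩
  · intro hy
    obtain ⟨z, hz, hzy⟩ := hYdd.ge hy
    have hz' : z = y := ι.injective hzy
    rw [← hz']
    exact hz

/-- `Π^tp_X̲` acts on `μ_1(B_N) = 1` "via the cyclotomic character" — trivially, for every `ι` and `m`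
(abc-iut-L2-t11's `CyclotomicCharacterCompatX`).  [cite: MochizukiEtTh2009, Lem 5.8 p.331 (PDF p.105)] -/
theorem cyclotomicCharacterCompatX_datum (m : datum.muTorsion datum.BN datum.N ≃* thetaEnvData.mu) :
    datum.CyclotomicCharacterCompatX thetaEnvData ι.toMulEquiv m :=
  fun _ _ _ _ => rfl

/-- The Prop. 5.2 (iii) dictionary `ThetaSectionCompat` (the bi-Kummer difference cocycle IS `η⁻¹` through `m`) holds
at the datum for every `ι`, `m`, `η`: both sides live in `μ_1 = 1`.  [cite: MochizukiEtTh2009, Prop 5.2 (iii) p.324 (PDF p.98)] -/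
theorem thetaSectionCompat_datum (H : datum.Facts) (m : datum.muTorsion datum.BN datum.N ≃* thetaEnvData.mu)
    (hYdd : datum.IdentifiesPiYdd thetaEnvData ι.toMulEquiv) (η : thetaEnvData.PiYdd → thetaEnvData.mu) :
    datum.ThetaSectionCompat H thetaEnvData ι.toMulEquiv m hYdd η :=
  fun _ => rfl

/-- **`ConstOutTransported` at the datum for every `DK ⊆ {1}`** (and every `ι`, `m`, `hY`, `hχ`): the outer action of the
constants is trivial there (`conjOut_eq_one`: the ambient group is abelian), so `constOut ∪ DK ⊆ {1}` is transported into
`D_Y` (indeed into `1 = D_Y`, f-115's `DY_eq_bot`).  Lemma 5.8's `K^×`-part of `D ↦ D_Y`, first half.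
[cite: MochizukiEtTh2009, Lem 5.8 p.331 (PDF p.105)] -/
theorem constOutTransported_datum_of_subset_one (H : datum.Facts) (h8 : datum.ConstantsEqNormalizer)
    {DK : Set (TopOut datum.EPiN)} (hDK : DK ⊆ {1}) (m : datum.muTorsion datum.BN datum.N ≃* thetaEnvData.mu)
    (hY : datum.IdentifiesPiY thetaEnvData ι.toMulEquiv)
    (hχ : datum.CyclotomicCharacterCompat thetaEnvData ι.toMulEquiv m) :
    datum.ConstOutTransported H h8 DK thetaEnvData ι m hY hχ := by
  rintro _ ⟨d, hd, rfl⟩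
  have hd1 : d = 1 := by
    rcases hd with ⟨u, rfl⟩ | hd
    · exact conjOut_eq_one _
    · exact hDK hd
  rw [hd1, map_one]
  exact Subgroup.one_mem _

/-- **`KummerOutReached` at the datum, always** (every `DK`, `ι`, `m`, `hY`, `hχ`): the Kummer part of `D_Y` consists of
shifts by `μ_1`-valued cocycles, all equal to `1` (f-115's `shift_eq_one`), and `1 ∈ D`.  Lemma 5.8's `K^×`-part of
`D ↦ D_Y`, second half.  [cite: MochizukiEtTh2009, Lem 5.8 p.331 (PDF p.105)] -/
theorem kummerOutReached_datum (H : datum.Facts) (h1 : datum.SectionsFactor) (h3 : datum.OuterActionLZ)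
    (hsec : datum.SgpCapSection) (hcs : datum.SgpCupSection) (h8 : datum.ConstantsEqNormalizer)
    (DK : Set (TopOut datum.EPiN)) (m : datum.muTorsion datum.BN datum.N ≃* thetaEnvData.mu)
    (hY : datum.IdentifiesPiY thetaEnvData ι.toMulEquiv)
    (hχ : datum.CyclotomicCharacterCompat thetaEnvData ι.toMulEquiv m) :
    datum.KummerOutReached H h1 h3 hsec hcs h8 DK thetaEnvData ι m hY hχ := by
  rintro x ⟨δ, hδ, hc, rfl⟩
  have h1' : (⟨CycEnvelope.shift hδ, hc⟩ : contMulAut thetaEnvData.env) = 1 := Subtype.ext (shift_eq_one hδ)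
  rw [h1', map_one]
  exact Subgroup.one_mem _

end Dictionary

/-! ### F-0545 / F-0546 HOLD at the datum through the instance form of record -/

/-- **F-0545 at the degenerate datum, positive side.**  For all §5 inputs, every Kummer part `DK ⊆ {1}` and every
continuous identification `ι` carrying `Π^tp_Y̲, Π^tp_Ÿ̲` onto `Π^tp_Y, Π^tp_Ÿ`, the typed Lemma 5.9 (iv) statement
`EnvIsoBiTheta` HOLDS — obtained by feeding abc-iut-L2-t11's instance form of record `envIsoBiTheta_of` with the datum's
dictionary (all seven hypotheses discharged above).  [cite: MochizukiEtTh2009, Lem 5.9 (iv) p.332 (PDF p.106)] -/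
theorem envIsoBiTheta_datum_of_subset_one (h1 : datum.SectionsFactor) (h3 : datum.OuterActionLZ)
    (hsec : datum.SgpCapSection) (hcs : datum.SgpCupSection) (h8 : datum.ConstantsEqNormalizer)
    {DK : Set (TopOut datum.EPiN)} (hDK : DK ⊆ {1}) (ι : datum.PiX ≃ₜ* thetaEnvData.PiX)
    (hY : datum.PiY.map ι.toMulEquiv.toMonoidHom = thetaEnvData.PiY)
    (hYdd : datum.PiYdd.map ι.toMulEquiv.toMonoidHom = thetaEnvData.PiYdd) :
    datum.EnvIsoBiTheta h1 h3 hsec hcs h8 DK thetaEnvData ι := by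
  obtain ⟨m⟩ := nonempty_muEquiv
  have hη : (fun _ => PUnit.unit : thetaEnvData.PiYdd → thetaEnvData.mu) ∈ thetaEnvData.thetaCocycles :=
    Set.mem_univ _
  exact datum.envIsoBiTheta_of facts_datum h1 h3 hsec hcs h8 DK thetaEnvData ι m (identifiesPiY_of_map_eq ι hY)
    (identifiesPiYdd_of_map_eq ι hYdd) (cyclotomicCharacterCompatX_datum ι m) hη
    (thetaSectionCompat_datum ι facts_datum m _ _)
    (constOutTransported_datum_of_subset_one ι facts_datum h8 hDK m _ _)
    (kummerOutReached_datum ι facts_datum h1 h3 hsec hcs h8 DK m _ _)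

/-- `ι := id` carries `Π^tp_Y̲` onto `Π^tp_Y` (the datum IS built over `thetaEnvData`).
[cite: MochizukiEtTh2009, Lem 5.9 (iv) p.332 (PDF p.106)] -/
theorem map_PiY_refl : datum.PiY.map (ContinuousMulEquiv.refl datum.PiX).toMulEquiv.toMonoidHom = thetaEnvData.PiY := by
  rw [map_refl_eq, datum_PiY]
  rfl

/-- `ι := id` carries `Π^tp_Ÿ̲` onto `Π^tp_Ÿ`. [cite: MochizukiEtTh2009, Lem 5.9 (iv) p.332 (PDF p.106)] -/
theorem map_PiYdd_refl :
    datum.PiYdd.map (ContinuousMulEquiv.refl datum.PiX).toMulEquiv.toMonoidHom = thetaEnvData.PiYdd := by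
  rw [map_refl_eq, datum_PiYdd]
  rfl

/-- **F-0545 HOLDS at the degenerate datum for `ι := id` and every `DK ⊆ {1}`.**
[cite: MochizukiEtTh2009, Lem 5.9 (iv) p.332 (PDF p.106)] -/
theorem envIsoBiTheta_datum_refl_of_subset_one (h1 : datum.SectionsFactor) (h3 : datum.OuterActionLZ)
    (hsec : datum.SgpCapSection) (hcs : datum.SgpCupSection) (h8 : datum.ConstantsEqNormalizer)
    {DK : Set (TopOut datum.EPiN)} (hDK : DK ⊆ {1}) :
    datum.EnvIsoBiTheta h1 h3 hsec hcs h8 DK thetaEnvData (ContinuousMulEquiv.refl datum.PiX) :=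
  envIsoBiTheta_datum_of_subset_one h1 h3 hsec hcs h8 hDK _ map_PiY_refl map_PiYdd_refl

/-- **F-0545 MODEL-WITNESSED: `EnvIsoBiTheta` HOLDS at the degenerate datum for `DK := ∅`, `ι := id`** (print's
`D = ⟨l·ℤ, K^×⟩` has no free part) — the first kernel inhabitant of abc-iut-L2-t4's typed Lemma 5.9 (iv) predicate,
obtained through the instance form of record.  With f-115's `not_envIsoBiTheta_datum_univ` / `_swap` the predicate
takes BOTH truth values at this datum.  [cite: MochizukiEtTh2009, Lem 5.9 (iv) p.332 (PDF p.106)] -/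
theorem envIsoBiTheta_datum_empty (h1 : datum.SectionsFactor) (h3 : datum.OuterActionLZ)
    (hsec : datum.SgpCapSection) (hcs : datum.SgpCupSection) (h8 : datum.ConstantsEqNormalizer) :
    datum.EnvIsoBiTheta h1 h3 hsec hcs h8 ∅ thetaEnvData (ContinuousMulEquiv.refl datum.PiX) :=
  envIsoBiTheta_datum_refl_of_subset_one h1 h3 hsec hcs h8 (Set.empty_subset _)

/-- **F-0546 MODEL-WITNESSED: `FrdIsMonoThetaEnv` HOLDS at the degenerate datum for `DK := ∅`** — "omitting the
homomorphism `s^⊓-Π_N` yields a mod `N` mono-theta environment" (Lemma 5.9 (iv), "In particular"), via abc-iut-L2-t4's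
`frdIsMonoThetaEnv_of`.  With f-115's `not_frdIsMonoThetaEnv_datum` the predicate takes BOTH truth values at this
datum.  [cite: MochizukiEtTh2009, Lem 5.9 (iv) p.332 (PDF p.106)] -/
theorem frdIsMonoThetaEnv_datum_empty (h1 : datum.SectionsFactor) (h3 : datum.OuterActionLZ)
    (hsec : datum.SgpCapSection) (hcs : datum.SgpCupSection) (h8 : datum.ConstantsEqNormalizer) :
    datum.FrdIsMonoThetaEnv h1 h3 hsec hcs h8 ∅ thetaEnvData :=
  datum.frdIsMonoThetaEnv_of h1 h3 hsec hcs h8 ∅ thetaEnvData _ (envIsoBiTheta_datum_empty h1 h3 hsec hcs h8)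

/-! ### The converse: an isomorphism with a model forces `DK ⊆ {1}` -/

/-- **Necessity.**  For ANY §2 datum `T` over the datum's `N = 1` whose `D_Y` is trivial and any Kummer part `DK`: if
abc-iut-L2-t4's Frobenioid-theoretic data `frdMonoThetaEnv … DK` IS a mono-theta environment for `T`, then `DK ⊆ {1}` —
`D = ⟨DK⟩` (`frdD_eq_closure`) is transported injectively onto `D_Y = 1` by the isomorphism (mechanism of f-115's
`not_frdIsMonoThetaEnv_datum_of_DY_eq_bot`, stated sharply).  [cite: MochizukiEtTh2009, Lem 5.9 (iv) p.332 (PDF p.106)] -/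
theorem subset_one_of_frdIsMonoThetaEnv (h1 : datum.SectionsFactor) (h3 : datum.OuterActionLZ)
    (hsec : datum.SgpCapSection) (hcs : datum.SgpCupSection) (h8 : datum.ConstantsEqNormalizer)
    {DK : Set (TopOut datum.EPiN)} (T : ThetaEnvData.{0} datum.N) (hDY : T.DY = ⊥)
    (h : datum.FrdIsMonoThetaEnv h1 h3 hsec hcs h8 DK T) : DK ⊆ {1} := by
  intro d hd
  obtain ⟨η, hη, ⟨i⟩⟩ := h
  have hmem : d ∈ (datum.frdMonoThetaEnv h1 h3 hsec hcs h8 DK).D := by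
    rw [frdD_eq_closure]
    exact Subgroup.subset_closure hd
  have h2 : TopOut.transport i.e d ∈ (T.modelMono hη).D := by
    rw [← i.map_D]
    exact Subgroup.mem_map_of_mem _ hmem
  change TopOut.transport i.e d ∈ T.DY at h2
  rw [hDY, Subgroup.mem_bot] at h2
  have hback := ThetaFrobenioid.transport_transport_symm_apply i.e.symm d
  rw [ContinuousMulEquiv.symm_symm, h2, map_one] at hback
  exact hback.symm

/-! ### The criteria -/

/-- **CRITERION (F-0546 at the degenerate datum).**  For all §5 inputs and EVERY Kummer part `DK`: the typed
"`frdMonoThetaEnv` is a mod `N` mono-theta environment" holds for the datum's own §2 datum IFF `DK ⊆ {1}`.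
[cite: MochizukiEtTh2009, Lem 5.9 (iv) p.332 (PDF p.106)] -/
theorem frdIsMonoThetaEnv_datum_iff (h1 : datum.SectionsFactor) (h3 : datum.OuterActionLZ)
    (hsec : datum.SgpCapSection) (hcs : datum.SgpCupSection) (h8 : datum.ConstantsEqNormalizer)
    (DK : Set (TopOut datum.EPiN)) :
    datum.FrdIsMonoThetaEnv h1 h3 hsec hcs h8 DK thetaEnvData ↔ DK ⊆ {1} :=
  ⟨subset_one_of_frdIsMonoThetaEnv h1 h3 hsec hcs h8 thetaEnvData DY_eq_bot, fun hDK =>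
    datum.frdIsMonoThetaEnv_of h1 h3 hsec hcs h8 DK thetaEnvData _
      (envIsoBiTheta_datum_refl_of_subset_one h1 h3 hsec hcs h8 hDK)⟩

/-- **CRITERION (F-0545 at the degenerate datum).**  For all §5 inputs, EVERY Kummer part `DK` and EVERY continuous
identification `ι : Π^tp_X̲ ≃ Π^tp_X`: the typed Lemma 5.9 (iv) statement holds IFF `ι` carries `Π^tp_Y̲, Π^tp_Ÿ̲` onto
`Π^tp_Y, Π^tp_Ÿ` AND `DK ⊆ {1}`.  The failure of the universal closure (f-115) is thereby LOCATED in the free pair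
(`DK`, `ι`) exactly.  [cite: MochizukiEtTh2009, Lem 5.9 (iv) p.332 (PDF p.106)] -/
theorem envIsoBiTheta_datum_iff (h1 : datum.SectionsFactor) (h3 : datum.OuterActionLZ)
    (hsec : datum.SgpCapSection) (hcs : datum.SgpCupSection) (h8 : datum.ConstantsEqNormalizer)
    (DK : Set (TopOut datum.EPiN)) (ι : datum.PiX ≃ₜ* thetaEnvData.PiX) :
    datum.EnvIsoBiTheta h1 h3 hsec hcs h8 DK thetaEnvData ι ↔
      (datum.PiY.map ι.toMulEquiv.toMonoidHom = thetaEnvData.PiY ∧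
        datum.PiYdd.map ι.toMulEquiv.toMonoidHom = thetaEnvData.PiYdd) ∧ DK ⊆ {1} := by
  constructor
  · intro h
    exact ⟨⟨h.1, h.2.1⟩, subset_one_of_frdIsMonoThetaEnv h1 h3 hsec hcs h8 thetaEnvData DY_eq_bot
      (datum.frdIsMonoThetaEnv_of h1 h3 hsec hcs h8 DK thetaEnvData ι h)⟩
  · rintro ⟨⟨hY, hYdd⟩, hDK⟩
    exact envIsoBiTheta_datum_of_subset_one h1 h3 hsec hcs h8 hDK ι hY hYdd

/-- The criterion at `ι := id`: `EnvIsoBiTheta … DK thetaEnvData id ↔ DK ⊆ {1}`.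
[cite: MochizukiEtTh2009, Lem 5.9 (iv) p.332 (PDF p.106)] -/
theorem envIsoBiTheta_datum_refl_iff (h1 : datum.SectionsFactor) (h3 : datum.OuterActionLZ)
    (hsec : datum.SgpCapSection) (hcs : datum.SgpCupSection) (h8 : datum.ConstantsEqNormalizer)
    (DK : Set (TopOut datum.EPiN)) :
    datum.EnvIsoBiTheta h1 h3 hsec hcs h8 DK thetaEnvData (ContinuousMulEquiv.refl datum.PiX) ↔ DK ⊆ {1} := by
  rw [envIsoBiTheta_datum_iff]
  exact ⟨fun h => h.2, fun h => ⟨⟨map_PiY_refl, map_PiYdd_refl⟩, h⟩⟩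

/-! ### f-115's negatives read through the criteria (sharpness in each free parameter) -/

/-- `Out(E^Π_N) ⊄ {1}` at the datum (f-115's non-trivial class of inversion) — so `DK := Set.univ` violates the
criterion: this is `not_envIsoBiTheta_datum_univ` / `not_frdIsMonoThetaEnv_datum`.
[cite: MochizukiEtTh2009, Lem 5.9 (iv) p.332 (PDF p.106)] -/
theorem not_univ_subset_one : ¬ ((Set.univ : Set (TopOut datum.EPiN)) ⊆ {1}) := by
  intro h
  obtain ⟨d, hd⟩ := exists_topOut_ne_one
  exact hd (h (Set.mem_univ d))

/-- `swap(Π^tp_Y̲) ≠ Π^tp_Y` — so `ι := swap` violates the criterion for every `DK`: this is f-115's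
`not_envIsoBiTheta_datum_swap`.  [cite: MochizukiEtTh2009, Lem 5.9 (iv) p.332 (PDF p.106)] -/
theorem map_PiY_swapTop_ne : datum.PiY.map swapTop.toMulEquiv.toMonoidHom ≠ thetaEnvData.PiY := by
  intro h
  have hy : (y₀ : datum.PiX) ∈ datum.PiY := by
    rw [datum_PiY]
    exact y₀_mem.1
  exact swap_y₀_not_mem (h.le (Subgroup.mem_map_of_mem _ hy))

/-- F-0546 re-derived negative through the criterion: at `DK := Set.univ` the typed predicate FAILS (f-115's
`not_frdIsMonoThetaEnv_datum`, now an instance of `frdIsMonoThetaEnv_datum_iff`).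
[cite: MochizukiEtTh2009, Lem 5.9 (iv) p.332 (PDF p.106)] -/
theorem not_frdIsMonoThetaEnv_datum_univ' (h1 : datum.SectionsFactor) (h3 : datum.OuterActionLZ)
    (hsec : datum.SgpCapSection) (hcs : datum.SgpCupSection) (h8 : datum.ConstantsEqNormalizer) :
    ¬ datum.FrdIsMonoThetaEnv h1 h3 hsec hcs h8 Set.univ thetaEnvData := fun h =>
  not_univ_subset_one ((frdIsMonoThetaEnv_datum_iff h1 h3 hsec hcs h8 _).mp h)

/-- F-0545 re-derived negative through the criterion, free `ι`: at `ι := swap` the typed predicate FAILS for every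
`DK` (f-115's `not_envIsoBiTheta_datum_swap`, now an instance of `envIsoBiTheta_datum_iff`).
[cite: MochizukiEtTh2009, Lem 5.9 (iv) p.332 (PDF p.106)] -/
theorem not_envIsoBiTheta_datum_swap' (h1 : datum.SectionsFactor) (h3 : datum.OuterActionLZ)
    (hsec : datum.SgpCapSection) (hcs : datum.SgpCupSection) (h8 : datum.ConstantsEqNormalizer)
    (DK : Set (TopOut datum.EPiN)) :
    ¬ datum.EnvIsoBiTheta h1 h3 hsec hcs h8 DK thetaEnvData swapTop := fun h =>
  map_PiY_swapTop_ne ((envIsoBiTheta_datum_iff h1 h3 hsec hcs h8 DK swapTop).mp h).1.1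

/-! ### F-0544 at the datum (completing tranche 123's truth table there) -/

/-- **F-0544 HOLDS at the degenerate datum for ALL parameters** (`N = 1`: abc-iut-w5-d026's boundary theorem
`cycRigidityCoincide_of_N_eq_one` — any two isomorphisms onto `μ_1(B_N) = 1` coincide).  Its universal closure is
refuted elsewhere at `N = 3` (`Lem59vToy.not_forall_cycRigidityCoincide`).  [cite: MochizukiEtTh2009, Lem 5.9 (v) p.332 (PDF p.106)] -/
theorem cycRigidityCoincide_datum (ρ219 : datum.lDeltaModN datum.BN ≃* datum.muTorsion datum.BN datum.N)
    (ρ : FrobenioidCyclotomicRigidity.RigidityFamily datum) (hB : datum.IsThetaSaturated datum.BN) :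
    datum.CycRigidityCoincide ρ219 ρ hB :=
  datum.cycRigidityCoincide_of_N_eq_one rfl ρ219 ρ hB

/-! ### v2 (append-only): CLOSED inhabitants — the five §5 input binders instantiated by f-115's `facts_datum`

RQ7 second read of v1 (abc-iut-w6-d059, INFO-1): the §5 inputs `h1 h3 hsec hcs h8` carried above as binders are all
THEOREMS at the datum (`facts_datum.sectionsFactor`, `datum.outerActionLZ_of`, `facts_datum.sgpCapSection`,
`facts_datum.sgpCupSection`, `facts_datum.constantsEqNormalizer`), so both typed Lemma 5.9 (iv) predicates have kernel
inhabitants with NO binder at all. -/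

/-- **F-0545, closed term**: `EnvIsoBiTheta` at the degenerate datum with the §5 inputs DISCHARGED (f-115's
`facts_datum`, abc-iut-L2-t4's `outerActionLZ_of`), `DK := ∅`, `T := thetaEnvData`, `ι := id` — an unconditional
kernel inhabitant of the typed predicate.  [cite: MochizukiEtTh2009, Lem 5.9 (iv) p.332 (PDF p.106)] -/
theorem envIsoBiTheta_datum_empty_facts :
    datum.EnvIsoBiTheta facts_datum.sectionsFactor datum.outerActionLZ_of facts_datum.sgpCapSection
      facts_datum.sgpCupSection facts_datum.constantsEqNormalizer ∅ thetaEnvData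
      (ContinuousMulEquiv.refl datum.PiX) :=
  envIsoBiTheta_datum_empty _ _ _ _ _

/-- **F-0546, closed term**: `FrdIsMonoThetaEnv` at the degenerate datum with the §5 inputs DISCHARGED, `DK := ∅`,
`T := thetaEnvData` — an unconditional kernel inhabitant of the typed predicate.
[cite: MochizukiEtTh2009, Lem 5.9 (iv) p.332 (PDF p.106)] -/
theorem frdIsMonoThetaEnv_datum_empty_facts :
    datum.FrdIsMonoThetaEnv facts_datum.sectionsFactor datum.outerActionLZ_of facts_datum.sgpCapSection
      facts_datum.sgpCupSection facts_datum.constantsEqNormalizer ∅ thetaEnvData :=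
  frdIsMonoThetaEnv_datum_empty _ _ _ _ _

/-- **F-0546, closed criterion**: with the §5 inputs discharged, `FrdIsMonoThetaEnv … DK thetaEnvData ↔ DK ⊆ {1}`
for every `DK`.  [cite: MochizukiEtTh2009, Lem 5.9 (iv) p.332 (PDF p.106)] -/
theorem frdIsMonoThetaEnv_datum_facts_iff (DK : Set (TopOut datum.EPiN)) :
    datum.FrdIsMonoThetaEnv facts_datum.sectionsFactor datum.outerActionLZ_of facts_datum.sgpCapSection
      facts_datum.sgpCupSection facts_datum.constantsEqNormalizer DK thetaEnvData ↔ DK ⊆ {1} :=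
  frdIsMonoThetaEnv_datum_iff _ _ _ _ _ DK

/-- **F-0545, closed criterion**: with the §5 inputs discharged, for every `DK` and every continuous `ι`,
`EnvIsoBiTheta … DK thetaEnvData ι ↔ (ι(Π^tp_Y̲) = Π^tp_Y ∧ ι(Π^tp_Ÿ̲) = Π^tp_Ÿ) ∧ DK ⊆ {1}`.
[cite: MochizukiEtTh2009, Lem 5.9 (iv) p.332 (PDF p.106)] -/
theorem envIsoBiTheta_datum_facts_iff (DK : Set (TopOut datum.EPiN)) (ι : datum.PiX ≃ₜ* thetaEnvData.PiX) :
    datum.EnvIsoBiTheta facts_datum.sectionsFactor datum.outerActionLZ_of facts_datum.sgpCapSection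
      facts_datum.sgpCupSection facts_datum.constantsEqNormalizer DK thetaEnvData ι ↔
      (datum.PiY.map ι.toMulEquiv.toMonoidHom = thetaEnvData.PiY ∧
        datum.PiYdd.map ι.toMulEquiv.toMonoidHom = thetaEnvData.PiYdd) ∧ DK ⊆ {1} :=
  envIsoBiTheta_datum_iff _ _ _ _ _ DK ι

end Sec5Toy

end Literature.AnabelianGeometry.EtaleTheta
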